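import Summits.NavierStokesRegularity.NavierStokesRegularity.Theorems.SoloSalvageWu2026WeakPairing
import Summits.NavierStokesRegularity.NavierStokesRegularity.Theorems.SoloSalvageWu2026WeakApprox
import Mathlib.Analysis.InnerProductSpace.PiL2
import HarnessLib

/-!
# C177 `Wu2026` — Prop 3.3 toolkit (part 3): the product rule with a smooth field and the
# transport identity `div(uV) = V·∇u` for divergence-free `V`

D-0090 NS-CLAIMS sweep, claim C177 (W. Wu, arXiv:2608.22471v1), skeleton
`Literature/Claims/NS/Wu2026.lean`; kernel objects for the binder `hP33` of `claim_of_steps''`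
(Proposition 3.3 p.20, `Step_P33`: «div(β(Q)V) = β′(Q)V·∇Q = 0», p.20 l.95–105, «By the Sobolev
chain and product rules»). In the vocabulary of
`Literature.Analysis.FunctionSpaces.HasWeakFDerivOn`:

* `hasWeakFDerivOn_clm_apply'` — weak derivatives commute with a fixed continuous linear map on
  the range (short reproof of the tree's `FluidPDE` copies, keeping the import closure small);
* `hasWeakFDerivOn_inner_contDiff_left` — `D⟪c, V⟫ = ⟪c, DV·⟫ + ⟪Dc·, V⟫` for `c` smooth and
  `V` weakly differentiable (orthonormal expansion + the tree's Leibniz rule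
  `SobolevApprox.hasWeakFDerivOn_smul`);
* `integral_mul_fderiv_apply_eq_of_divFree` — **the transport identity**: if `∫ ∇ψ·V = 0` for
  all test functions `ψ` on `Ω` (`div V = 0` weakly), `V ∈ L^{p'} ∩ L^{q'}(Ω)`, and `u ∈ L^p(Ω)`
  has the weak derivative `∇u ∈ L^q(Ω)` (`1/p + 1/p' = 1 = 1/q + 1/q'`), then
  `∫ u ∇φ·V = −∫ φ ∇u·V` for every test function `φ` on `Ω`. Proof: mollify `u` (part 2, two
  exponents), test `div V = 0` with `φ uₙ`, pass to the limit (part 1).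

Seat ns-in-wu-p33 (cell pub/ns-inputs, D-0154 (2) INPUTS). WHAT THIS IS NOT: not a claim about
NS regularity or blow-up; no summit statement is proved here.
-/

noncomputable section

set_option linter.dupNamespace false

open MeasureTheory TopologicalSpace Set Function Filter Topology Metric
open scoped ENNReal NNReal Topology ContDiff RealInnerProductSpace

namespace Summit.NavierStokesRegularity.NavierStokesRegularity.Theorems.Wu2026Salvage

open Literature.Analysis.FunctionSpaces

variable {E : Type*} [NormedAddCommGroup E] [InnerProductSpace ℝ E] [FiniteDimensional ℝ E]
  [MeasurableSpace E] [BorelSpace E] {μ : Measure E} [μ.IsAddHaarMeasure]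
variable {F : Type*} [NormedAddCommGroup F] [NormedSpace ℝ F] [CompleteSpace F]
variable {F' : Type*} [NormedAddCommGroup F'] [NormedSpace ℝ F'] [CompleteSpace F']

/-! ### Bookkeeping: supports, set integrals, measurability -/

omit [InnerProductSpace ℝ E] [FiniteDimensional ℝ E] [MeasurableSpace E] [BorelSpace E]
  [μ.IsAddHaarMeasure] [CompleteSpace F] in
/-- If `P` vanishes off `K ⊆ S` then `∫_S P = ∫_K P`. [folklore] -/
theorem setIntegral_eq_setIntegral_of_forall_notMem_eq_zero {X : Type*} [MeasurableSpace X]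
    {ν : Measure X} {P : X → F} {K S : Set X} (hK : ∀ x, x ∉ K → P x = 0) (hKS : K ⊆ S) :
    ∫ x in S, P x ∂ν = ∫ x in K, P x ∂ν := by
  rw [setIntegral_eq_integral_of_forall_compl_eq_zero fun x hx => hK x fun h => hx (hKS h),
    setIntegral_eq_integral_of_forall_compl_eq_zero fun x hx => hK x hx]

omit [FiniteDimensional ℝ E] [BorelSpace E] [μ.IsAddHaarMeasure] [CompleteSpace F] in
/-- `x ↦ L x (v x)` is a.e.-strongly measurable for a.e.-strongly measurable `L`, `v`. [folklore] -/
theorem aestronglyMeasurable_clm_apply {ν : Measure E} {L : E → E →L[ℝ] F} {v : E → E}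
    (hL : AEStronglyMeasurable L ν) (hv : AEStronglyMeasurable v ν) :
    AEStronglyMeasurable (fun x => L x (v x)) ν :=
  (isBoundedBilinearMap_apply (𝕜 := ℝ) (E := E) (F := F)).continuous.comp_aestronglyMeasurable
    (hL.prodMk hv)

omit [BorelSpace E] [μ.IsAddHaarMeasure] [CompleteSpace F] in
/-- An operator-valued continuous compactly supported `L` with support in the open set `U`,
applied to a field `v` locally integrable on `U`, gives an integrable function. [folklore] -/
theorem integrable_clm_apply_of_tsupport_subset [OpensMeasurableSpace E] {U : Set E}
    {L : E → E →L[ℝ] F} {v : E → E} (hL : Continuous L) (hLc : HasCompactSupport L)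
    (hLU : tsupport L ⊆ U) (hv : LocallyIntegrableOn v U μ) :
    Integrable (fun x => L x (v x)) μ := by
  have hvK : IntegrableOn v (tsupport L) μ := hv.integrableOn_compact_subset hLU hLc
  obtain ⟨C, hC⟩ := hL.bounded_above_of_compact_support hLc
  have h1 : IntegrableOn (fun x => L x (v x)) (tsupport L) μ := by
    refine Integrable.mono' (hvK.norm.const_mul C) ?_ ?_
    · exact aestronglyMeasurable_clm_apply hL.aestronglyMeasurable.restrict hvK.1
    · filter_upwards with x
      calc ‖L x (v x)‖ ≤ ‖L x‖ * ‖v x‖ := (L x).le_opNorm _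
        _ ≤ C * ‖v x‖ := by gcongr; exact hC x
  refine (integrableOn_iff_integrable_of_support_subset ?_).1 h1
  intro x hx
  refine subset_tsupport _ fun h0 => hx ?_
  simp only [h0, zero_apply]

/-! ### Weak derivatives and continuous linear maps on the range -/

omit [FiniteDimensional ℝ E] [BorelSpace E] [μ.IsAddHaarMeasure] in
/-- Weak derivatives commute with a fixed continuous linear map on the range: if `g` is a weak
derivative of `f` on `Ω` then `x ↦ L ∘ g x` is one of `L ∘ f` (apply `L` to the defining
identity; Evans, *PDE*, §5.2.3 Thm. 1). Same statement as the tree's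
`FunctionSpaces.HasWeakFDerivOn.clm_comp` (`FluidPDE/CKNPressureHessianSlice`), reproved to keep
this file's imports light. [folklore] -/
theorem hasWeakFDerivOn_clm_apply' [OpensMeasurableSpace E] {Ω : Opens E}
    {f : E → F} {g : E → E →L[ℝ] F} (h : HasWeakFDerivOn Ω μ f g) (L : F →L[ℝ] F') :
    HasWeakFDerivOn Ω μ (fun x => L (f x)) (fun x => L.comp (g x)) := by
  refine ⟨L.locallyIntegrableOn_comp h.locallyIntegrableOn,
    (ContinuousLinearMap.compL ℝ E F F' L).locallyIntegrableOn_comp h.locallyIntegrableOn_deriv,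
    fun φ v hφ => ?_⟩
  have I₁ := SobolevApprox.integrableOn_fderiv_testFunction_smul hφ v h.locallyIntegrableOn
  have J₁ := SobolevApprox.integrableOn_testFunction_smul hφ
    (SobolevApprox.locallyIntegrableOn_deriv_apply h v)
  have e1 : (fun x => fderiv ℝ φ x v • L (f x)) = fun x => L (fderiv ℝ φ x v • f x) := by
    funext x; rw [L.map_smul]
  have e2 : (fun x => φ x • (L.comp (g x)) v) = fun x => L (φ x • g x v) := by
    funext x; rw [L.map_smul]; rfl
  rw [e1, e2, L.integral_comp_comm I₁, L.integral_comp_comm J₁, h.integral_fderiv_smul_eq φ v hφ,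
    L.map_neg]

/-! ### The product rule with a smooth vector field -/

section Inner

variable {H : Type*} [NormedAddCommGroup H] [InnerProductSpace ℝ H] [FiniteDimensional ℝ H]

omit [μ.IsAddHaarMeasure] in
/-- **Product rule `D⟪c, V⟫ = ⟪c, DV·⟫ + ⟪Dc·, V⟫`** for a smooth field `c` and a weakly
differentiable field `V` with values in a finite-dimensional inner product space (Evans, *PDE*,
§5.2.3 Thm. 1 (iv), one smooth factor): expand `⟪c, V⟫ = Σᵢ ⟪c, bᵢ⟫ ⟪bᵢ, V⟫` along an
orthonormal basis, apply the tree's Leibniz rule `SobolevApprox.hasWeakFDerivOn_smul` to each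
term, and resum. [cite: Evans2010, §5.2.3 Thm. 1 (iv)] -/
theorem hasWeakFDerivOn_inner_contDiff_left {Ω : Opens E} {V : E → H}
    {gV : E → E →L[ℝ] H} (hV : HasWeakFDerivOn Ω μ V gV) {c : E → H} (hc : ContDiff ℝ ∞ c) :
    HasWeakFDerivOn Ω μ (fun x => ⟪c x, V x⟫)
      (fun x => (innerSL ℝ (c x)).comp (gV x) + (innerSL ℝ (V x)).comp (fderiv ℝ c x)) := by
  haveI : CompleteSpace H := FiniteDimensional.complete ℝ H
  set b := stdOrthonormalBasis ℝ H with hb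
  -- coefficients `ζᵢ = ⟪bᵢ, c⟫` are smooth with derivative `⟪bᵢ, Dc ·⟫`
  have hζ : ∀ i, ContDiff ℝ ∞ fun x => (innerSL ℝ (b i)) (c x) := fun i =>
    (innerSL ℝ (b i)).contDiff.comp hc
  have hcd : Differentiable ℝ c := hc.differentiable (by simp)
  have hζd : ∀ i x, fderiv ℝ (fun x => (innerSL ℝ (b i)) (c x)) x =
      (innerSL ℝ (b i)).comp (fderiv ℝ c x) := fun i x =>
    ((innerSL ℝ (b i)).hasFDerivAt.comp x (hcd x).hasFDerivAt).fderiv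
  -- each term `ζᵢ • ⟪bᵢ, V⟫`
  have hi : ∀ i ∈ Finset.univ, HasWeakFDerivOn Ω μ
      (fun x => (innerSL ℝ (b i)) (c x) • (innerSL ℝ (b i)) (V x))
      (fun x => (innerSL ℝ (b i)) (c x) • (innerSL ℝ (b i)).comp (gV x) +
        (fderiv ℝ (fun x => (innerSL ℝ (b i)) (c x)) x).smulRight ((innerSL ℝ (b i)) (V x))) :=
    fun i _ => SobolevApprox.hasWeakFDerivOn_smul (hasWeakFDerivOn_clm_apply' hV (innerSL ℝ (b i)))
      (hζ i)
  have hsum := SobolevApprox.hasWeakFDerivOn_sum Finset.univ hi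
  refine SobolevApprox.hasWeakFDerivOn_congr hsum (fun x _ => ?_) (fun x _ => ?_)
  · -- the function
    rw [Finset.sum_apply]
    simp only [innerSL_apply_apply, smul_eq_mul]
    rw [← b.sum_inner_mul_inner (c x) (V x)]
    refine Finset.sum_congr rfl fun i _ => ?_
    rw [real_inner_comm (b i) (c x)]
  · -- the derivative
    rw [Finset.sum_apply]
    ext w
    have hterm : ∀ i, ((innerSL ℝ (b i)) (c x) • (innerSL ℝ (b i)).comp (gV x) +
        (fderiv ℝ (fun x => (innerSL ℝ (b i)) (c x)) x).smulRight ((innerSL ℝ (b i)) (V x))) w =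
        ⟪c x, b i⟫ * ⟪b i, gV x w⟫ + ⟪fderiv ℝ c x w, b i⟫ * ⟪b i, V x⟫ := by
      intro i
      rw [hζd i, add_apply, smul_apply, ContinuousLinearMap.comp_apply,
        ContinuousLinearMap.smulRight_apply, ContinuousLinearMap.comp_apply]
      simp only [innerSL_apply_apply, smul_eq_mul]
      rw [real_inner_comm (b i) (c x), real_inner_comm (b i) (fderiv ℝ c x w)]
    rw [add_apply, ContinuousLinearMap.comp_apply, ContinuousLinearMap.comp_apply, sum_apply,
      Finset.sum_congr rfl fun i _ => hterm i, Finset.sum_add_distrib, b.sum_inner_mul_inner,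
      b.sum_inner_mul_inner]
    simp only [innerSL_apply_apply]
    rw [real_inner_comm (V x) (fderiv ℝ c x w)]

end Inner

/-! ### The transport identity `div(uV) = V·∇u` for divergence-free `V` -/

omit [NormedSpace ℝ F] [CompleteSpace F] in
/-- A continuous function is in every `L^p(μ|_K)` for compact `K`. [folklore] -/
theorem memLp_restrict_of_continuous_isCompact {f : E → F} (hf : Continuous f) {K : Set E}
    (hK : IsCompact K) (p : ℝ≥0∞) : MemLp f p (μ.restrict K) := by
  haveI : IsFiniteMeasure (μ.restrict K) :=
    ⟨by rw [Measure.restrict_apply_univ]; exact hK.measure_lt_top⟩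
  obtain ⟨C, hC⟩ := hK.exists_bound_of_continuousOn hf.continuousOn
  have htop : MemLp f ⊤ (μ.restrict K) :=
    memLp_top_of_bound hf.aestronglyMeasurable C (ae_restrict_of_forall_mem hK.measurableSet hC)
  exact htop.mono_exponent le_top

/-- **Transport identity.** Let `Ω` be open, `V ∈ L^{p'}(Ω) ∩ L^{q'}(Ω)` a vector field with
`∫ ∇ψ·V = 0` for all test functions `ψ` on `Ω` (i.e. `div V = 0` in `D'(Ω)`), and `u ∈ L^p(Ω)` a
scalar with weak derivative `∇u ∈ L^q(Ω)` on `Ω`, where `1/p + 1/p' = 1 = 1/q + 1/q'`,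
`1 ≤ p, q < ∞`. Then for every test function `φ` on `Ω`,
`∫ u (∇φ·V) = −∫ φ (∇u·V)`, i.e. `div(uV) = V·∇u` in `D'(Ω)` (the step «div(β(Q)V) = β′(Q)V·∇Q»
of p.20 l.95–100, and the step `div(V_e V) = V·∇V_e` behind (3.51) ⟹ `∇P = −(V·∇)V`, p.20
l.40–50). Proof: interior mollification `uₙ` of `u` (two exponents), the hypothesis tested with
`φ uₙ`, and the Hölder limit passage. [cite: Wu2026, Prop 3.3 proof p.20 l.40–100] -/
theorem integral_mul_fderiv_apply_eq_of_divFree {Ω : Opens E} {V : E → E} {u : E → ℝ}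
    {gu : E → E →L[ℝ] ℝ} {p p' q q' : ℝ≥0∞} [ENNReal.HolderTriple p p' 1]
    [ENNReal.HolderTriple q q' 1] (hp : 1 ≤ p) (hp' : p ≠ ⊤) (hq : 1 ≤ q) (hq' : q ≠ ⊤)
    (hu : HasWeakFDerivOn Ω μ u gu) (hup : MemLp u p (μ.restrict Ω))
    (hguq : MemLp gu q (μ.restrict Ω)) (hVp : MemLp V p' (μ.restrict Ω))
    (hVq : MemLp V q' (μ.restrict Ω))
    (hdiv : ∀ ψ : E → ℝ, ContDiff ℝ ∞ ψ → HasCompactSupport ψ → tsupport ψ ⊆ (Ω : Set E) →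
      ∫ x, fderiv ℝ ψ x (V x) ∂μ = 0)
    {φ : E → ℝ} (hφ : ContDiff ℝ ∞ φ) (hφc : HasCompactSupport φ)
    (hφΩ : tsupport φ ⊆ (Ω : Set E)) :
    ∫ x, u x * fderiv ℝ φ x (V x) ∂μ = -∫ x, φ x * gu x (V x) ∂μ := by
  set K : Set E := tsupport φ with hK_def
  have hK : IsCompact K := hφc
  have hKm : MeasurableSet K := (isClosed_tsupport φ).measurableSet
  obtain ⟨w, hws, hwp, hwq, -⟩ :=
    exists_smooth_approx_two_exponents hu hp hp' hq hq' hup hguq hK hφΩ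
  have hφd : Differentiable ℝ φ := hφ.differentiable (by simp)
  have hDφc : Continuous (fderiv ℝ φ) := hφ.continuous_fderiv (by simp)
  obtain ⟨Cφ, hCφ⟩ := hφ.continuous.bounded_above_of_compact_support hφc
  obtain ⟨CDφ, hCDφ⟩ := hDφc.bounded_above_of_compact_support (hφc.fderiv ℝ)
  -- the finite measure `ν = μ|_K` and the data on it
  set ν : Measure E := μ.restrict K with hν
  haveI : IsFiniteMeasure ν := ⟨by rw [hν, Measure.restrict_apply_univ]; exact hK.measure_lt_top⟩
  have hνΩ : ν ≤ μ.restrict (Ω : Set E) := Measure.restrict_mono hφΩ le_rfl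
  have hVpν : MemLp V p' ν := hVp.mono_measure hνΩ
  have hVqν : MemLp V q' ν := hVq.mono_measure hνΩ
  have hupν : MemLp u p ν := hup.mono_measure hνΩ
  have hguν : MemLp gu q ν := hguq.mono_measure hνΩ
  have hVm : AEStronglyMeasurable V ν := hVpν.1
  have hwd : ∀ n, Differentiable ℝ (w n) := fun n => (hws n).differentiable (by simp)
  have hwc : ∀ n, Continuous (w n) := fun n => (hws n).continuous
  have hDwc : ∀ n, Continuous (fderiv ℝ (w n)) := fun n => (hws n).continuous_fderiv (by simp)
  have hwpν : ∀ n, MemLp (w n) p ν := fun n => memLp_restrict_of_continuous_isCompact (hwc n) hK p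
  have hDwqν : ∀ n, MemLp (fderiv ℝ (w n)) q ν := fun n =>
    memLp_restrict_of_continuous_isCompact (hDwc n) hK q
  -- the two weights `ω₁ = ∇φ·V ∈ L^{p'}`, `ω₂ = φ V ∈ L^{q'}`
  set ω₁ : E → ℝ := fun x => fderiv ℝ φ x (V x) with hω₁
  set ω₂ : E → E := fun x => φ x • V x with hω₂
  have hω₁m : AEStronglyMeasurable ω₁ ν :=
    aestronglyMeasurable_clm_apply hDφc.aestronglyMeasurable hVm
  have hω₁ν : MemLp ω₁ p' ν := by
    refine hVpν.of_le_mul hω₁m (c := CDφ) (Eventually.of_forall fun x => ?_)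
    exact ((fderiv ℝ φ x).le_opNorm _).trans (mul_le_mul_of_nonneg_right (hCDφ x) (norm_nonneg _))
  have hω₂ν : MemLp ω₂ q' ν := by
    refine hVqν.of_le_mul (hφ.continuous.aestronglyMeasurable.smul hVm) (c := Cφ)
      (Eventually.of_forall fun x => ?_)
    rw [hω₂, norm_smul]
    exact mul_le_mul_of_nonneg_right (hCφ x) (norm_nonneg _)
  -- supports
  have hφ0 : ∀ x, x ∉ K → φ x = 0 := fun x hx => image_eq_zero_of_notMem_tsupport hx
  have hDφ0 : ∀ x, x ∉ K → fderiv ℝ φ x = 0 := fun x hx => fderiv_of_notMem_tsupport ℝ hx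
  -- integrability of the four pairings on `ν`
  have hI1 : ∀ n, Integrable (fun x => w n x * ω₁ x) ν := fun n =>
    integrable_of_norm_le_mul (p := p) (q := p') (C := 1)
      ((hwc n).aestronglyMeasurable.mul hω₁m) (hwpν n) hω₁ν fun x => by rw [one_mul, norm_mul]
  have hI2 : ∀ n, Integrable (fun x => φ x * fderiv ℝ (w n) x (V x)) ν := fun n =>
    integrable_of_norm_le_mul (p := q) (q := q') (C := 1)
      (hφ.continuous.aestronglyMeasurable.mul
        (aestronglyMeasurable_clm_apply (hDwc n).aestronglyMeasurable hVm)) (hDwqν n) hω₂ν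
      fun x => by
        rw [one_mul, hω₂, norm_smul, norm_mul, mul_left_comm]
        exact mul_le_mul_of_nonneg_left ((fderiv ℝ (w n) x).le_opNorm _) (norm_nonneg _)
  have hI3 : Integrable (fun x => u x * ω₁ x) ν :=
    integrable_of_norm_le_mul (p := p) (q := p') (C := 1) (hupν.1.mul hω₁m) hupν hω₁ν
      fun x => by rw [one_mul, norm_mul]
  have hI4 : Integrable (fun x => φ x * gu x (V x)) ν :=
    integrable_of_norm_le_mul (p := q) (q := q') (C := 1)
      (hφ.continuous.aestronglyMeasurable.mul (aestronglyMeasurable_clm_apply hguν.1 hVm))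
      hguν hω₂ν fun x => by
        rw [one_mul, hω₂, norm_smul, norm_mul, mul_left_comm]
        exact mul_le_mul_of_nonneg_left ((gu x).le_opNorm _) (norm_nonneg _)
  -- Step 1: the identity for the smooth approximants, `∫ wₙ ∇φ·V = -∫ φ ∇wₙ·V` on `ν`
  have hstep : ∀ n, ∫ x, w n x * ω₁ x ∂ν = -∫ x, φ x * fderiv ℝ (w n) x (V x) ∂ν := by
    intro n
    have hψ : ContDiff ℝ ∞ fun x => φ x * w n x := hφ.mul (hws n)
    have hψc : HasCompactSupport fun x => φ x * w n x := hφc.mul_right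
    have hψΩ : tsupport (fun x => φ x * w n x) ⊆ (Ω : Set E) :=
      (tsupport_mul_subset_left (f := φ) (g := w n)).trans hφΩ
    have h0 := hdiv _ hψ hψc hψΩ
    have hderiv : ∀ x, fderiv ℝ (fun x => φ x * w n x) x (V x) =
        w n x * ω₁ x + φ x * fderiv ℝ (w n) x (V x) := fun x => by
      rw [fderiv_fun_mul (hφd x) (hwd n x), add_apply, smul_apply, smul_apply, smul_eq_mul,
        smul_eq_mul, add_comm]
    simp_rw [hderiv] at h0
    -- move to `ν`: the integrand vanishes off `K`
    have hK0 : ∀ x, x ∉ K → w n x * ω₁ x + φ x * fderiv ℝ (w n) x (V x) = 0 := fun x hx => by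
      simp only [hω₁, hDφ0 x hx, hφ0 x hx, zero_apply, mul_zero, zero_mul, add_zero]
    rw [← setIntegral_eq_integral_of_forall_compl_eq_zero (s := K) (fun x hx => hK0 x hx)] at h0
    rw [integral_add (hI1 n) (hI2 n)] at h0
    linarith
  -- Step 2: pass to the limit on both sides
  have hlimL : Tendsto (fun n => ∫ x, w n x * ω₁ x ∂ν) atTop (𝓝 (∫ x, u x * ω₁ x ∂ν)) := by
    refine tendsto_integral_of_norm_sub_le_mul (p := p) (q := p') (C := 1)
      (fun n => (hwc n).aestronglyMeasurable.mul hω₁m) hI3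
      (fun n => (hwc n).aestronglyMeasurable) hupν.1 hω₁ν (fun n x => ?_) ?_
    · rw [← sub_mul, norm_mul, one_mul]
    · simpa [Pi.sub_def] using hwp
  have hlimR : Tendsto (fun n => ∫ x, φ x * fderiv ℝ (w n) x (V x) ∂ν) atTop
      (𝓝 (∫ x, φ x * gu x (V x) ∂ν)) := by
    refine tendsto_integral_of_norm_sub_le_mul (p := q) (q := q') (C := 1)
      (fun n => hφ.continuous.aestronglyMeasurable.mul
        (aestronglyMeasurable_clm_apply (hDwc n).aestronglyMeasurable hVm)) hI4
      (fun n => (hDwc n).aestronglyMeasurable) hguν.1 hω₂ν (fun n x => ?_) ?_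
    · rw [← mul_sub, ← sub_apply, norm_mul, one_mul, hω₂, norm_smul, mul_left_comm]
      exact mul_le_mul_of_nonneg_left ((fderiv ℝ (w n) x - gu x).le_opNorm _) (norm_nonneg _)
    · simpa [Pi.sub_def] using hwq
  have hEq : ∫ x, u x * ω₁ x ∂ν = -∫ x, φ x * gu x (V x) ∂ν := by
    have h2 := hlimR.neg
    have h1' : Tendsto (fun n => ∫ x, w n x * ω₁ x ∂ν) atTop (𝓝 (-∫ x, φ x * gu x (V x) ∂ν)) :=
      h2.congr fun n => (hstep n).symm
    exact tendsto_nhds_unique hlimL h1'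
  -- Step 3: back to the whole space
  have hL0 : ∀ x, x ∉ K → u x * ω₁ x = 0 := fun x hx => by
    simp only [hω₁, hDφ0 x hx, zero_apply, mul_zero]
  have hR0 : ∀ x, x ∉ K → φ x * gu x (V x) = 0 := fun x hx => by
    rw [hφ0 x hx, zero_mul]
  rw [← setIntegral_eq_integral_of_forall_compl_eq_zero (s := K) (fun x hx => hL0 x hx),
    ← setIntegral_eq_integral_of_forall_compl_eq_zero (s := K) (fun x hx => hR0 x hx)]
  exact hEq

end Summit.NavierStokesRegularity.NavierStokesRegularity.Theorems.Wu2026Salvage
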